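import Mathlib.FieldTheory.Separable
import Literature.Computability.AlgebraicComplexity.ApproximateRootsVieta
import Literature.Computability.AlgebraicComplexity.EsymmWitnessDegree
import Literature.Computability.AlgebraicComplexity.RootLifting
import Literature.Computability.AlgebraicComplexity.BlaserJindalSymmetric
import HarnessLib

/-!
# Bläser–Jindal 2019, Theorem 4 (polynomial form): the witness of a symmetric polynomial has
# small circuits — PROOF of the named fact `BlaserJindal2019_thm4`

Topic `Computability/AlgebraicComplexity`; namespace `Literature.Computability.AlgebraicComplexity`.
M. Bläser, G. Jindal, *On the Complexity of Symmetric Polynomials*, ITCS 2019, LIPIcs 124,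
47:1–47:14, Thm. 4 with the Remark after it (held text p0003:L27–34): for `f ∈ ℂ[y_1, …, y_n]` and
`f_Sym = f(e_1, …, e_n)` (`e_k` the elementary symmetric polynomials in `x_1, …, x_n`),
`L(f) ≤ poly(L(f_Sym), deg f_Sym, n)`. The tree's named fact `BlaserJindal2019_thm4`
(`BlaserJindalSymmetric.lean`) is the polynomial form `∃ c, ∀ n f, L(f) ≤ (L(f_Sym) + deg f_Sym + n + 2)^c`
in the tree's vocabulary (`complexity`, Mathlib's `MvPolynomial.esymm`); it is PROVED here
(`BlaserJindal2019_thm4_holds`, with `c = 8`), so that its consumer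
`Summit.ValiantsHypothesis.ValiantsHypothesis.Theorems.qpSymmetric_of_entrySymmetric`
(route MonotoneRestoration, crux `MonotoneRestorationQP`) becomes unconditional.

## The argument (print's §4, made root-free — ROUTE DEVIATION disclosed)

Print (§4, Algorithm 1 / Thm. 16 / Lemma 18): Newton iteration for the POWER-SERIES roots of
`B(y) = y^n - e_1 y^{n-1} + … ± e_n` around a point with distinct roots, substitution of the truncated
roots into the circuit for `f_Sym`, one truncation. Power-series roots are not polynomials, so we run
the same iteration without ever naming the roots:

1. Base point `a_i = i` (distinct), `b_k = e_k(a)`; `G(y, z) = y^n + Σ_i (-1)^{i+1} (b_{i+1} + z_i) y^{n-1-i}`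
   (so `G(y, 0) = Π_j (y - a_j)`, Vieta), an explicit polynomial of circuit size `≤ n² + 4n + 1`
   (`complexity_bjPoly_le`).
2. For each `i`, `D` steps of the tree's slow Newton (chord) iteration (`RootLifting.lean`,
   `complexity_newton_iterate_le`: cost `≤ D (L(G) + 2)` each) from `C a_i` give `ψ_i ∈ ℂ[z]` with
   constant term `a_i` and `G(ψ_i, z) ∈ ⟨z⟩^{D+1}` (`ApproximateRootsVieta.lean`,
   `newton_iterate_eval_mem`: the root-free Newton invariant).
3. Vieta from approximate roots (`sub_esymm_mem_pow_idealOfVars_of_eval_mem`, factor theorem in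
   `ℂ[z] ⧸ ⟨z⟩^{D+1}` where the differences `ψ_i - ψ_j` are units): `e_k(ψ) ≡ b_k + z_{k-1}`, hence
   `f_Sym(ψ) ≡ f(b + z) (mod ⟨z⟩^{D+1})`.
4. DEGREE LEMMA `totalDegree_le_totalDegree_aeval_esymm` (`EsymmWitnessDegree.lean`): `deg f ≤ deg f_Sym`
   (the weight-`w` part of `f` maps to the degree-`w` homogeneous component of `f_Sym`, injectively
   by the fundamental theorem `MvPolynomial.esymmAlgHom_injective`). So with `D = deg f_Sym`, `f(b + z)` is
   the truncation of `f_Sym(ψ)` at degree `D` — ONE truncation,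
   `complexity_sum_homogeneousComponent_le` (BCS Lemma 21.25) — and `f(y) = f(b + z)|_{z = y - b}`
   (a free translation). Total: `L(f) ≤ (D+2)² (L(f_Sym) + n D (n² + 4n + 3)) + D + 1 + n ≤
   (L(f_Sym) + D + n + 2)^8` (`complexity_le_of_aeval_esymm`, stated over ANY field of characteristic
   zero; `BlaserJindal2019_thm4_holds` is its instance `F = ℂ`).

STATEMENT = print's polynomial form (lit g12 PROOF-SOURCES §6.12: MATCH, weaker than print's
`Õ(d² L(f_Sym) + d² n²)`); ROUTE ≠ print (root-free invariant + approximate Vieta instead of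
power-series roots); no new definitions, no named facts. Honest framing: circuit-complexity
bookkeeping of symmetric polynomials; nothing here bears on VP versus VNP, which is NOT proved.

References: [BlaserJindal2019] Thm. 4, Remark, §4; [DuttaSaxenaSinhababu2018] §1.3 (slow Newton
iteration); [BurgisserClausenShokrollahi1997] Lemma (21.25) (homogeneous components);
[Burgisser2000] Rem. 2.7 (substitution).
-/

noncomputable section

namespace Literature.Computability.AlgebraicComplexity

open MvPolynomial Finset

/-! ### §1 Substitutions of degree `≤ 1`; truncation; a power of a variable -/

section Aux

variable {F : Type*} [Field F] {β : Type*}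

/-- The constant coefficient of `φ(z)` for `φ ∈ F[x][y]`, `z ∈ F[x]`, is `φ₀(z(0))` where `φ₀` is
`φ` with every coefficient replaced by its constant term. [folklore] -/
private theorem bj_constantCoeff_eval (φ : Polynomial (MvPolynomial β F))
    (z : MvPolynomial β F) :
    constantCoeff (φ.eval z) =
      (φ.map (constantCoeff : MvPolynomial β F →+* F)).eval (constantCoeff z) :=
  (Polynomial.eval_map_apply (constantCoeff : MvPolynomial β F →+* F) (x := z)).symm

/-- A substitution by polynomials of degree `≤ 1` does not raise the total degree. [folklore] -/
private theorem bj_totalDegree_aeval_le {γ : Type*} (t : β → MvPolynomial γ F)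
    (ht : ∀ b, (t b).totalDegree ≤ 1) (p : MvPolynomial β F) :
    (aeval t p).totalDegree ≤ p.totalDegree := by
  classical
  conv_lhs => rw [p.as_sum]
  rw [map_sum]
  refine totalDegree_finsetSum_le fun m hm => ?_
  rw [aeval_monomial, algebraMap_eq]
  refine (totalDegree_mul _ _).trans ?_
  rw [totalDegree_C, zero_add]
  simp only [Finsupp.prod]
  refine (totalDegree_finsetProd _ _).trans ?_
  calc ∑ i ∈ m.support, (t i ^ m i).totalDegree ≤ ∑ i ∈ m.support, m i := by
        refine Finset.sum_le_sum fun i _ => (totalDegree_pow _ _).trans ?_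
        calc m i * (t i).totalDegree ≤ m i * 1 := Nat.mul_le_mul_left _ (ht i)
          _ = m i := mul_one _
    _ ≤ p.totalDegree := by
        have := le_totalDegree hm
        simpa only [Finsupp.sum] using this

/-- If `q ≡ g (mod ⟨x⟩^{D+1})` and `deg g ≤ D` then the truncation of `q` at degree `D` is `g`.
[folklore] -/
private theorem sum_homogeneousComponent_eq_of_sub_mem {D : ℕ} {q g : MvPolynomial β F}
    (h : q - g ∈ idealOfVars β F ^ (D + 1)) (hD : g.totalDegree ≤ D) :
    ∑ i ∈ range (D + 1), homogeneousComponent i q = g := by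
  rw [mem_pow_idealOfVars_iff_homogeneousComponent] at h
  have heq : ∀ i ∈ range (D + 1), homogeneousComponent i q = homogeneousComponent i g :=
    fun i hi => by
      have := h i (mem_range.1 hi)
      rwa [map_sub, sub_eq_zero] at this
  rw [sum_congr rfl heq]
  calc ∑ i ∈ range (D + 1), homogeneousComponent i g
      = ∑ i ∈ range (g.totalDegree + 1), homogeneousComponent i g := by
        refine (Finset.sum_subset (Finset.range_mono (by omega)) fun i hi hi' => ?_).symm
        refine homogeneousComponent_eq_zero _ _ ?_
        simp only [mem_range, not_lt] at hi hi'
        omega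
    _ = g := sum_homogeneousComponent g

variable [Fintype β]

/-- `L(y^j) ≤ j`. [folklore] -/
private theorem bj_complexity_X_pow_le {σ : Type*} (v : σ) (j : ℕ) :
    complexity (X v ^ j : MvPolynomial σ F) ≤ j := by
  induction j with
  | zero => rw [pow_zero, ← C_1, complexity_C_holds]
  | succ j ih =>
    rw [pow_succ]
    calc complexity (X v ^ j * X v) ≤ complexity (X v ^ j : MvPolynomial σ F) +
          complexity (X v : MvPolynomial σ F) + 1 := complexity_mul_le_holds _ _
      _ ≤ j + 0 + 1 := by gcongr; exact (complexity_X_holds v).le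

end Aux

/-! ### §2 The polynomial `G(y, z) = y^n + Σ_i (-1)^{i+1} (b_i + z_i) y^{n-1-i}` -/

section BJPoly

variable {F : Type*} [Field F] {n : ℕ}

/-- **Cost of `G`**: `L(G) ≤ n² + 4n + 1` for
`G = y^n + Σ_i (-1)^{i+1} (b_i + z_i) y^{n-1-i}` (`y = X none`, `z_i = X (some i)`).
[cite: BlaserJindal2019, §4] -/
theorem complexity_bjPoly_le (b : Fin n → F) :
    complexity (X none ^ n + ∑ i : Fin n, (-1) ^ ((i : ℕ) + 1) * (C (b i) + X (some i)) *
        X none ^ (n - 1 - (i : ℕ)) : MvPolynomial (Option (Fin n)) F) ≤ n ^ 2 + 4 * n + 1 := by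
  have hterm : ∀ i : Fin n, complexity ((-1) ^ ((i : ℕ) + 1) * (C (b i) + X (some i)) *
      X none ^ (n - 1 - (i : ℕ)) : MvPolynomial (Option (Fin n)) F) ≤ n + 2 := by
    intro i
    have hsign : ((-1 : MvPolynomial (Option (Fin n)) F) ^ ((i : ℕ) + 1)) =
        C ((-1 : F) ^ ((i : ℕ) + 1)) := by
      rw [map_pow, map_neg, C_1]
    rw [hsign]
    have hi := i.isLt
    calc complexity (C ((-1 : F) ^ ((i : ℕ) + 1)) * (C (b i) + X (some i)) *
          X none ^ (n - 1 - (i : ℕ)) : MvPolynomial (Option (Fin n)) F)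
        ≤ complexity (C ((-1 : F) ^ ((i : ℕ) + 1)) * (C (b i) + X (some i)) :
            MvPolynomial (Option (Fin n)) F) +
          complexity (X none ^ (n - 1 - (i : ℕ)) : MvPolynomial (Option (Fin n)) F) + 1 :=
          complexity_mul_le_holds _ _
      _ ≤ (complexity (C ((-1 : F) ^ ((i : ℕ) + 1)) : MvPolynomial (Option (Fin n)) F) +
            complexity (C (b i) + X (some i) : MvPolynomial (Option (Fin n)) F) + 1) +
          (n - 1 - (i : ℕ)) + 1 := by
          gcongr
          · exact complexity_mul_le_holds _ _
          · exact bj_complexity_X_pow_le _ _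
      _ ≤ (0 + (0 + 0 + 1) + 1) + (n - 1 - (i : ℕ)) + 1 := by
          gcongr
          · exact (complexity_C_holds _).le
          · exact (complexity_add_le_holds _ _).trans
              (by rw [complexity_C_holds, complexity_X_holds])
      _ ≤ n + 2 := by omega
  calc complexity (X none ^ n + ∑ i : Fin n, (-1) ^ ((i : ℕ) + 1) * (C (b i) + X (some i)) *
        X none ^ (n - 1 - (i : ℕ)) : MvPolynomial (Option (Fin n)) F)
      ≤ complexity (X none ^ n : MvPolynomial (Option (Fin n)) F) +
        complexity (∑ i : Fin n, (-1) ^ ((i : ℕ) + 1) * (C (b i) + X (some i)) *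
          X none ^ (n - 1 - (i : ℕ)) : MvPolynomial (Option (Fin n)) F) + 1 :=
        complexity_add_le_holds _ _
    _ ≤ n + (∑ i : Fin n, complexity ((-1) ^ ((i : ℕ) + 1) * (C (b i) + X (some i)) *
          X none ^ (n - 1 - (i : ℕ)) : MvPolynomial (Option (Fin n)) F) +
          (univ : Finset (Fin n)).card) + 1 := by
        gcongr
        · exact bj_complexity_X_pow_le _ _
        · exact complexity_finset_sum_le _ _
    _ ≤ n + (∑ _i : Fin n, (n + 2) + (univ : Finset (Fin n)).card) + 1 := by
        gcongr with i _
        exact hterm i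
    _ = n ^ 2 + 4 * n + 1 := by
        rw [Finset.sum_const, Finset.card_univ, Fintype.card_fin, smul_eq_mul]
        ring

/-- Under `optionEquivLeft`, `G` is the Vieta-form polynomial in `y` with coefficients
`c_i = (-1)^{i+1} (b_i + z_i) ∈ F[z]`.
[cite: BlaserJindal2019, §4 (proof of Thm. 4: the polynomial F(y, e) = yⁿ − e₁yⁿ⁻¹ + ⋯)] -/
theorem optionEquivLeft_bjPoly (b : Fin n → F) :
    optionEquivLeft F (Fin n) (X none ^ n + ∑ i : Fin n, (-1) ^ ((i : ℕ) + 1) *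
        (C (b i) + X (some i)) * X none ^ (n - 1 - (i : ℕ))) =
      Polynomial.X ^ n + ∑ i : Fin n, Polynomial.C ((-1) ^ ((i : ℕ) + 1) * (C (b i) + X i)) *
        Polynomial.X ^ (n - 1 - (i : ℕ)) := by
  simp only [map_add, map_pow, map_sum, map_mul, map_neg, map_one, optionEquivLeft_X_none,
    optionEquivLeft_X_some, optionEquivLeft_C]

/-- At `z = 0` the Vieta-form polynomial with coefficients `(-1)^{i+1}(e_{i+1}(a) + z_i)` is
`Π_j (y - a_j)` (Vieta's formulas).
[cite: Lang2002, Ch. IV §6 (elementary symmetric polynomials: Π(X − tᵢ) = Xⁿ − s₁Xⁿ⁻¹ + ⋯ ± sₙ)] -/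
theorem map_constantCoeff_bjVieta (a : Fin n → F) :
    (Polynomial.X ^ n + ∑ i : Fin n, Polynomial.C ((-1) ^ ((i : ℕ) + 1) *
        (C (((univ : Finset (Fin n)).val.map a).esymm ((i : ℕ) + 1)) + X i)) *
          Polynomial.X ^ (n - 1 - (i : ℕ)) : Polynomial (MvPolynomial (Fin n) F)).map
        (constantCoeff : MvPolynomial (Fin n) F →+* F) =
      ∏ j : Fin n, (Polynomial.X - Polynomial.C (a j)) := by
  rw [prod_X_sub_C_eq_X_pow_add_sum]
  simp only [Polynomial.map_add, Polynomial.map_pow, Polynomial.map_X, Polynomial.map_sum,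
    Polynomial.map_mul, Polynomial.map_C, Polynomial.map_neg, Polynomial.map_one, map_mul, map_pow,
    map_neg, map_one, map_add, map_zero, constantCoeff_C, constantCoeff_X, add_zero]

end BJPoly

/-! ### §3 The witness has small circuits -/

section Main

variable {F : Type*} [Field F] [CharZero F] {n : ℕ}

/-- **Bläser–Jindal, Thm. 4, explicit polynomial form** (over any field `F` of characteristic
zero; the paper works over `ℂ`). For `f ∈ F[y_1, …, y_n]` with `f_Sym = f(e_1, …, e_n)` of circuit
size `s` and total degree `D`:
`L(f) ≤ (D+2)² (s + n D (n² + 4n + 3)) + (D + 1) + n` — `n` slow Newton iterations of `D` steps,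
one substitution into the circuit for `f_Sym`, one truncation at degree `D`, one translation.
[cite: BlaserJindal2019, Thm. 4 and §4] -/
theorem complexity_le_of_aeval_esymm (f : MvPolynomial (Fin n) F) :
    complexity f ≤
      ((aeval (fun i : Fin n => MvPolynomial.esymm (Fin n) F ((i : ℕ) + 1)) f).totalDegree + 2) ^ 2 *
        (complexity (aeval (fun i : Fin n => MvPolynomial.esymm (Fin n) F ((i : ℕ) + 1)) f) +
          n * ((aeval (fun i : Fin n => MvPolynomial.esymm (Fin n) F ((i : ℕ) + 1)) f).totalDegree *
            (n ^ 2 + 4 * n + 3))) +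
      ((aeval (fun i : Fin n => MvPolynomial.esymm (Fin n) F ((i : ℕ) + 1)) f).totalDegree + 1) +
        n := by
  classical
  -- notation
  set e : Fin n → MvPolynomial (Fin n) F := fun i => MvPolynomial.esymm (Fin n) F ((i : ℕ) + 1)
    with he
  set g := aeval e f with hg
  set D := g.totalDegree with hD
  -- base point with distinct coordinates and its elementary symmetric values
  set a : Fin n → F := fun i => ((i : ℕ) : F) with ha
  have hainj : Function.Injective a := by
    intro i j h
    have h' : ((i : ℕ) : F) = ((j : ℕ) : F) := h
    exact Fin.ext (by exact_mod_cast h')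
  set b : Fin n → F := fun i => ((univ : Finset (Fin n)).val.map a).esymm ((i : ℕ) + 1) with hb
  -- the polynomial `G` and its univariate form `φ`
  set G : MvPolynomial (Option (Fin n)) F := X none ^ n + ∑ i : Fin n, (-1) ^ ((i : ℕ) + 1) *
    (C (b i) + X (some i)) * X none ^ (n - 1 - (i : ℕ)) with hG
  set c : Fin n → MvPolynomial (Fin n) F := fun i => (-1) ^ ((i : ℕ) + 1) * (C (b i) + X i)
    with hc
  set φ : Polynomial (MvPolynomial (Fin n) F) := optionEquivLeft F (Fin n) G with hφ
  have hφV : φ = Polynomial.X ^ n + ∑ i : Fin n, Polynomial.C (c i) *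
      Polynomial.X ^ (n - 1 - (i : ℕ)) := by
    rw [hφ, hG, optionEquivLeft_bjPoly]
  have hφ0 : φ.map (constantCoeff : MvPolynomial (Fin n) F →+* F) =
      ∏ j : Fin n, (Polynomial.X - Polynomial.C (a j)) := by
    rw [hφV, hc]
    exact map_constantCoeff_bjVieta a
  -- the Newton data at the root `a i`
  have hroot : ∀ i : Fin n, constantCoeff (φ.eval (C (a i))) = 0 := by
    intro i
    rw [bj_constantCoeff_eval, hφ0, constantCoeff_C, Polynomial.eval_prod]
    exact Finset.prod_eq_zero (mem_univ i) (by simp)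
  have hsep : (∏ j : Fin n, (Polynomial.X - Polynomial.C (a j))).Separable :=
    Polynomial.separable_prod_X_sub_C_iff.2 hainj
  set ξ : Fin n → F := fun i => constantCoeff ((Polynomial.derivative φ).eval (C (a i))) with hξ
  have hξ0 : ∀ i : Fin n, ξ i ≠ 0 := by
    intro i
    have h := hsep.eval₂_derivative_ne_zero (RingHom.id F) (x := a i)
      (by
        rw [Polynomial.eval₂_eq_eval_map, Polynomial.map_id, Polynomial.eval_prod]
        exact Finset.prod_eq_zero (mem_univ i) (by simp))
    rw [Polynomial.eval₂_eq_eval_map, Polynomial.map_id] at h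
    show constantCoeff ((Polynomial.derivative φ).eval (C (a i))) ≠ 0
    rw [bj_constantCoeff_eval, ← Polynomial.derivative_map, hφ0, constantCoeff_C]
    exact h
  -- the Newton iterates `ψ_i`
  set ψ : Fin n → MvPolynomial (Fin n) F := fun i =>
    (fun z => z - C (ξ i)⁻¹ * φ.eval z)^[D] (C (a i)) with hψ
  have hψcc : ∀ i, constantCoeff (ψ i) = a i := fun i =>
    newton_iterate_constantCoeff φ (a i) (ξ i) (hroot i) rfl (hξ0 i) D
  have hψmem : ∀ i, φ.eval (ψ i) ∈ idealOfVars (Fin n) F ^ (D + 1) := fun i =>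
    newton_iterate_eval_mem φ (a i) (ξ i) (hroot i) rfl (hξ0 i) D
  -- Vieta from the approximate roots `ψ_i`
  have hvieta : ∀ i : Fin n,
      c i - (-1) ^ ((i : ℕ) + 1) * ((univ : Finset (Fin n)).val.map ψ).esymm ((i : ℕ) + 1) ∈
        idealOfVars (Fin n) F ^ (D + 1) := by
    refine sub_esymm_mem_pow_idealOfVars_of_eval_mem c ψ (fun i j hij => ?_) (fun i => ?_)
    · rw [hψcc, hψcc]; exact hainj.ne hij
    · rw [← hφV]; exact hψmem i
  set I := idealOfVars (Fin n) F ^ (D + 1) with hI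
  -- `e_{i+1}(ψ) ≡ b_i + z_i (mod I)`
  have hcong : ∀ i : Fin n, aeval ψ (e i) - (C (b i) + X i) ∈ I := by
    intro i
    have h := hvieta i
    have hsq : ((-1 : MvPolynomial (Fin n) F) ^ ((i : ℕ) + 1)) * (-1) ^ ((i : ℕ) + 1) = 1 := by
      rw [← mul_pow, neg_one_mul, neg_neg, one_pow]
    have h2 : aeval ψ (e i) - (C (b i) + X i) =
        -((-1) ^ ((i : ℕ) + 1)) * (c i - (-1) ^ ((i : ℕ) + 1) *
          ((univ : Finset (Fin n)).val.map ψ).esymm ((i : ℕ) + 1)) := by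
      rw [he, hc]
      simp only
      rw [MvPolynomial.aeval_esymm_eq_multiset_esymm]
      linear_combination ((C (b i) + X i : MvPolynomial (Fin n) F) -
        ((univ : Finset (Fin n)).val.map ψ).esymm ((i : ℕ) + 1)) * hsq
    rw [h2]
    exact Ideal.mul_mem_left _ _ h
  -- `f_Sym(ψ) ≡ f(b + z) (mod I)`
  set v : Fin n → MvPolynomial (Fin n) F := fun i => C (b i) + X i with hv
  have hg' : aeval ψ g = aeval (fun i => aeval ψ (e i)) f := by
    rw [hg, MvPolynomial.comp_aeval_apply]
  have hdiff : aeval ψ g - aeval v f ∈ I := by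
    rw [← Ideal.Quotient.eq, hg']
    change Ideal.Quotient.mkₐ F I (aeval (fun i => aeval ψ (e i)) f) =
      Ideal.Quotient.mkₐ F I (aeval v f)
    rw [MvPolynomial.comp_aeval_apply, MvPolynomial.comp_aeval_apply]
    have huv : (fun i => Ideal.Quotient.mkₐ F I (aeval ψ (e i))) =
        fun i => Ideal.Quotient.mkₐ F I (v i) :=
      funext fun i => (Ideal.Quotient.eq (I := I)).2 (hcong i)
    rw [huv]
  -- truncation at degree `D`
  have hdegf : f.totalDegree ≤ D := totalDegree_le_totalDegree_aeval_esymm f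
  have hdegv : (aeval v f).totalDegree ≤ D := by
    refine (bj_totalDegree_aeval_le v (fun i => ?_) f).trans hdegf
    refine (totalDegree_add _ _).trans (max_le ?_ ?_)
    · rw [totalDegree_C]; exact Nat.zero_le _
    · rw [totalDegree_X]
  have htrunc : ∑ k ∈ range (D + 1), homogeneousComponent k (aeval ψ g) = aeval v f :=
    sum_homogeneousComponent_eq_of_sub_mem hdiff hdegv
  -- translating back
  set wv : Fin n → MvPolynomial (Fin n) F := fun i => X i + C (-(b i)) with hwv
  have hback : aeval wv (aeval v f) = f := by
    rw [MvPolynomial.comp_aeval_apply]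
    conv_rhs => rw [← MvPolynomial.aeval_X_left_apply f]
    have hX : (fun i => aeval wv (v i)) = (X : Fin n → MvPolynomial (Fin n) F) := by
      funext i
      rw [hv, hwv]
      simp only [map_add, aeval_C, aeval_X, algebraMap_eq, map_neg]
      ring
    rw [hX]
  -- costs
  have hGc : complexity G ≤ n ^ 2 + 4 * n + 1 := complexity_bjPoly_le b
  have hψc : ∀ i, complexity (ψ i) ≤ D * (n ^ 2 + 4 * n + 3) := by
    intro i
    have h := complexity_newton_iterate_le G (ξ i) (a i) D
    rw [← hφ] at h
    refine h.trans ?_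
    calc D * (complexity G + 2) ≤ D * (n ^ 2 + 4 * n + 1 + 2) := by gcongr
      _ = D * (n ^ 2 + 4 * n + 3) := by ring
  have hh : complexity (aeval ψ g) ≤ complexity g + n * (D * (n ^ 2 + 4 * n + 3)) := by
    calc complexity (aeval ψ g) ≤ complexity g + ∑ i, complexity (ψ i) := complexity_aeval_le _ _
      _ ≤ complexity g + ∑ _i : Fin n, D * (n ^ 2 + 4 * n + 3) := by
          gcongr with i _
          exact hψc i
      _ = complexity g + n * (D * (n ^ 2 + 4 * n + 3)) := by
          rw [Finset.sum_const, Finset.card_univ, Fintype.card_fin, smul_eq_mul]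
  have hT : complexity (aeval v f) ≤
      (D + 2) ^ 2 * (complexity g + n * (D * (n ^ 2 + 4 * n + 3))) + (D + 1) := by
    rw [← htrunc]
    calc complexity (∑ k ∈ range (D + 1), homogeneousComponent k (aeval ψ g))
        ≤ (D + 2) ^ 2 * complexity (aeval ψ g) + (D + 1) :=
          complexity_sum_homogeneousComponent_le _ D
      _ ≤ (D + 2) ^ 2 * (complexity g + n * (D * (n ^ 2 + 4 * n + 3))) + (D + 1) := by gcongr
  have hwvc : ∑ i, complexity (wv i) ≤ n := by
    calc ∑ i, complexity (wv i) ≤ ∑ _i : Fin n, 1 := by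
          refine Finset.sum_le_sum fun i _ => ?_
          rw [hwv]
          calc complexity (X i + C (-(b i)) : MvPolynomial (Fin n) F)
              ≤ complexity (X i : MvPolynomial (Fin n) F) +
                complexity (C (-(b i)) : MvPolynomial (Fin n) F) + 1 := complexity_add_le_holds _ _
            _ = 1 := by rw [complexity_X_holds, complexity_C_holds]
      _ = n := by rw [Finset.sum_const, Finset.card_univ, Fintype.card_fin, smul_eq_mul, mul_one]
  calc complexity f = complexity (aeval wv (aeval v f)) := by rw [hback]
    _ ≤ complexity (aeval v f) + ∑ i, complexity (wv i) := complexity_aeval_le _ _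
    _ ≤ (D + 2) ^ 2 * (complexity g + n * (D * (n ^ 2 + 4 * n + 3))) + (D + 1) + n :=
        add_le_add hT hwvc

/-- Final arithmetic: `(d+2)² (s + n d (n² + 4n + 3)) + (d+1) + n ≤ (s + d + n + 2)^8`. [folklore] -/
private theorem bj_bound_arith (s d n : ℕ) :
    (d + 2) ^ 2 * (s + n * (d * (n ^ 2 + 4 * n + 3))) + (d + 1) + n ≤ (s + d + n + 2) ^ 8 := by
  set B := s + d + n + 2 with hB
  have hd : d + 2 ≤ B := by omega
  have hn : n + 2 ≤ B := by omega
  have hs : s ≤ B := by omega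
  have h1 : (d + 2) ^ 2 ≤ B ^ 2 := Nat.pow_le_pow_left hd 2
  have h2 : n ^ 2 + 4 * n + 3 ≤ B ^ 2 := by nlinarith
  have h3 : n * (d * (n ^ 2 + 4 * n + 3)) ≤ B * (B * B ^ 2) :=
    Nat.mul_le_mul (by omega) (Nat.mul_le_mul (by omega) h2)
  have hB4 : B ≤ B ^ 4 := Nat.le_self_pow (by norm_num) B
  have h4 : s + n * (d * (n ^ 2 + 4 * n + 3)) ≤ 2 * B ^ 4 := by
    have : B * (B * B ^ 2) = B ^ 4 := by ring
    omega
  have h5 : (d + 2) ^ 2 * (s + n * (d * (n ^ 2 + 4 * n + 3))) ≤ B ^ 2 * (2 * B ^ 4) :=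
    Nat.mul_le_mul h1 h4
  have h6 : d + 1 + n ≤ B := by omega
  have hB6 : B ≤ B ^ 6 := Nat.le_self_pow (by norm_num) B
  have h8 : 3 * B ^ 6 ≤ B ^ 8 := by
    have h3le : 3 ≤ B ^ 2 := by nlinarith
    calc 3 * B ^ 6 ≤ B ^ 2 * B ^ 6 := Nat.mul_le_mul_right _ h3le
      _ = B ^ 8 := by ring
  have h9 : B ^ 2 * (2 * B ^ 4) = 2 * B ^ 6 := by ring
  calc (d + 2) ^ 2 * (s + n * (d * (n ^ 2 + 4 * n + 3))) + (d + 1) + n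
      ≤ B ^ 2 * (2 * B ^ 4) + B := by omega
    _ ≤ 3 * B ^ 6 := by omega
    _ ≤ B ^ 8 := h8

/-- **Bläser–Jindal 2019, Thm. 4 (polynomial form) holds**: the named fact
`BlaserJindal2019_thm4` — `∃ c, ∀ n f, L(f) ≤ (L(f_Sym) + deg f_Sym + n + 2)^c` — with `c = 8`.
[cite: BlaserJindal2019, Thm. 4 and Remark (p. 47:3); §4] -/
theorem BlaserJindal2019_thm4_holds : BlaserJindal2019_thm4 := by
  refine ⟨8, fun n f => ?_⟩
  exact (complexity_le_of_aeval_esymm f).trans (bj_bound_arith _ _ _)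

end Main

end Literature.Computability.AlgebraicComplexity

end
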